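import Summits.ResolutionOfSingularities.ResolutionOfSingularities.Theorems.EquisingularLiftEquisingularLiftNatP1VBPicProjectiveLine
import Literature.AlgebraicGeometry.Modules.SerreTwistCharts
import Literature.AlgebraicGeometry.Modules.MatrixCocycleFrame
import Literature.AlgebraicGeometry.Modules.PullbackFrame
import Literature.AlgebraicGeometry.Modules.AdaptedFrame
import Literature.AlgebraicGeometry.Modules.IsoOfFrames
import HarnessLib

/-!
# [OURS · L1 W4.5(b) · T-P1VB part 7] The monomial cocycle `(x₁/x₀)^a (x₀/x₁)^b` on `ℙ¹_R` and its glued line bundle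
# `𝒪_{ℙ¹_R}(b − a)`; base change; every line bundle on `ℙ¹_k` is the restriction of a line bundle on `ℙ¹_A`

Cell res-hironaka, LADDER-RESOLUTION rung L (D-0089), slot W4.5(b), crux `Theses.EquisingularLift.EquisingularLiftNat`
(stmt-ResolutionOfSingularities-20038) / child `EquisingularLiftNatThree` (stmt-ResolutionOfSingularities-20148); object **T-P1VB**
(res-L1-w45b-lead-2 BOOK 2026-08-27T09:28:20Z; supplier debt (c) of `Cruxes/…/DIRSTEP.lean` = `Theorems/…NatDirZeroDefs.lean`:
«lift the downstairs line bundle K₀ on the rational carrier curve to the O-curve»), `--supports stmt-ResolutionOfSingularities-20148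
--as helper`. NOT a statement of any manuscript; OURS. AI-written; AI review is weaker than expert review.

WHAT.
* `monomialFun R a b i j V` — the transition FUNCTION `(x_j/x_i)|^a (x_i/x_j)|^b ∈ Γ(ℙ¹_R, V)` (`V ≤ D₊(x_i) ∩ D₊(x_j)`; `= 1` for
  `i = j`), its restriction / diagonal / cocycle identities (tree `SerreTwist.chartFun_cocycle`);
* `monomialCocycle R a b : MatrixCocycle (ℙ¹_R) (Fin 2)` [OURS def] — the `1×1` cocycle on the standard cover (tree
  `Modules/MatrixCocycleGluing`); its glued module `(monomialCocycle R a b).glued` is the line bundle `𝒪_{ℙ¹_R}(b − a)`, finite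
  locally free (`isFiniteLocallyFree_monomialGlued`), with frames on `D₊(x₀)`, `D₊(x₁)` and transition `monomialFun` (tree
  `MatrixCocycle.transition_frame`);
* `appLE_projMap_chartFun` — **`g♯(x_i/x_j) = x_i/x_j`** for `g = Proj(A[x] → k[x]) : ℙ¹_k → ℙ¹_A` (Mathlib
  `Proj.awayToSection_comp_appLE`, `HomogeneousLocalization.Away.map_mk`; the two spellings of `x_i/x_j` by `chartFun_eq_awayToSection`);
  `appLE_projMap_monomialFun`;
* `transition_eq_of_fin_one` — for size-one frames on a two-member cover, equality of the `(0,1)` transition functions gives equality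
  of all transition matrices;
* **`nonempty_iso_pullback_monomialGlued`** — `g^*(glued_A(a,b)) ≅ glued_k(a,b)` (tree `PullbackFrame.transition_pullbackFrame`,
  `AdaptedFrame.transition_restrictTrivialisation`, `IsoOfFrames.isoOfFrames`);
* **`exists_iso_monomialGlued`** (`k` a field) — every line bundle on `ℙ¹_k` is `≅ glued_k(a,b) = 𝒪(b − a)` (part 6
  `exists_frames_transition_eq_monomial` + `isoOfFrames`) — `Pic ℙ¹_k = ℤ·𝒪(1)` in module form;
* **`exists_iso_pullback_of_lineBundle`** — for ANY commutative `A` with an algebra map to the field `k`: every line bundle `L` on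
  `ℙ¹_k` is `≅ g^* L̃` with `L̃ = glued_A(a,b)` finite locally free on `ℙ¹_A` — the LIFT of `K₀` the v8 DIR₀ supplier needs (with
  `A = O` local and `k` its residue field, `L̃ = 𝒪_{ℙ¹_O}(b − a)`).

References (index only): Hartshorne II Prop. 2.5, II Ex. 5.18, II.6 (`Pic ℙ¹`); Görtz–Wedhorn I §(11.17), (13.9).
-/

noncomputable section

-- `TopCat.Presheaf`/`Scheme.Modules` are not reducible (as in Mathlib's `AlgebraicGeometry/Modules`).
set_option backward.isDefEq.respectTransparency false

open CategoryTheory AlgebraicGeometry TopologicalSpace Opposite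
open Literature.AlgebraicGeometry.Morphisms Literature.AlgebraicGeometry.Modules Literature.AlgebraicGeometry
open Literature.Algebra.Homology.LaurentCech (Xs Xs_mem Xs_singleton)
open Literature.AlgebraicGeometry.Motives.ProjBaseChangeRing (mapGraded mapGraded_apply irrelevant_le_map)

attribute [local instance] MvPolynomial.gradedAlgebra Literature.AlgebraicGeometry.Motives.ProjBaseChange.algebraBase

set_option linter.dupNamespace false -- mandated namespace `Summit.<Summit>.<Problem>` of this single-conjunct summit

namespace Summit.ResolutionOfSingularities.ResolutionOfSingularities.Cruxes.EquisingularLiftNat.P1VB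

/-! ### The monomial cocycle on the standard cover of `ℙ¹_R` -/

section Cocycle

variable (R : Type) [CommRing R] (a b : ℕ)

/-- The transition FUNCTION `τ_{ij} = (x_j/x_i)|^a (x_i/x_j)|^b` over `V ≤ D₊(x_i) ∩ D₊(x_j)` (for `i = j` it is `1`).
[folklore] -/
def monomialFun (i j : Fin 2) (V : (ProjCech.PP R 1).Opens) (hi : V ≤ ProjCech.Zop (𝟙 (ProjCech.PP R 1)) {i})
    (hj : V ≤ ProjCech.Zop (𝟙 (ProjCech.PP R 1)) {j}) : Γ(ProjCech.PP R 1, V) :=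
  (ProjCech.PP R 1).presheaf.map (homOfLE hi).op (SerreTwist.chartFun (𝟙 (ProjCech.PP R 1)) j i) ^ a *
    (ProjCech.PP R 1).presheaf.map (homOfLE hj).op (SerreTwist.chartFun (𝟙 (ProjCech.PP R 1)) i j) ^ b

/-- Restriction of the transition function. [folklore] -/
theorem map_monomialFun (i j : Fin 2) {V V' : (ProjCech.PP R 1).Opens} (hi : V ≤ ProjCech.Zop (𝟙 (ProjCech.PP R 1)) {i})
    (hj : V ≤ ProjCech.Zop (𝟙 (ProjCech.PP R 1)) {j}) (l : V' ≤ V) :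
    (ProjCech.PP R 1).presheaf.map (homOfLE l).op (monomialFun R a b i j V hi hj) =
      monomialFun R a b i j V' (l.trans hi) (l.trans hj) := by
  unfold monomialFun
  rw [map_mul, map_pow, map_pow, ← CategoryTheory.comp_apply, ← Functor.map_comp, ← CategoryTheory.comp_apply,
    ← Functor.map_comp]
  rfl

/-- `τ_{ii} = 1`. [folklore] -/
theorem monomialFun_self (i : Fin 2) (V : (ProjCech.PP R 1).Opens) (hi hi' : V ≤ ProjCech.Zop (𝟙 (ProjCech.PP R 1)) {i}) :
    monomialFun R a b i i V hi hi' = 1 := by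
  unfold monomialFun
  rw [SerreTwist.chartFun_self, map_one, one_pow, one_pow, one_mul]

/-- The cocycle identity `τ_{ij} τ_{jl} = τ_{il}` (from `x_l/x_i = (x_l/x_j)(x_j/x_i)`). [folklore] -/
theorem monomialFun_mul (i j l : Fin 2) (V : (ProjCech.PP R 1).Opens) (hi : V ≤ ProjCech.Zop (𝟙 (ProjCech.PP R 1)) {i})
    (hj : V ≤ ProjCech.Zop (𝟙 (ProjCech.PP R 1)) {j}) (hl : V ≤ ProjCech.Zop (𝟙 (ProjCech.PP R 1)) {l}) :
    monomialFun R a b i j V hi hj * monomialFun R a b j l V hj hl = monomialFun R a b i l V hi hl := by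
  unfold monomialFun
  rw [SerreTwist.chartFun_cocycle (𝟙 (ProjCech.PP R 1)) l i j hi hj,
    SerreTwist.chartFun_cocycle (𝟙 (ProjCech.PP R 1)) i l j hl hj]
  ring

/-- **[OURS] The monomial cocycle `g_{ij} = ((x_j/x_i)^a (x_i/x_j)^b)` of `1×1` matrices on the standard cover of `ℙ¹_R`**
(tree `Modules/MatrixCocycleGluing.MatrixCocycle`); its glued module is the line bundle `𝒪_{ℙ¹_R}(b − a)` with frames on
`D₊(x₀)`, `D₊(x₁)` and transition function `(x₁/x₀)^a (x₀/x₁)^b`. [folklore] -/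
def monomialCocycle : MatrixCocycle (ProjCech.PP R 1) (Fin 2) where
  U i := ProjCech.Zop (𝟙 (ProjCech.PP R 1)) {i}
  I _ := Fin 1
  g i j V hi hj := Matrix.of fun _ _ => monomialFun R a b i j V hi hj
  map_g i j V V' hi hj l := by
    ext p q
    rw [Matrix.map_apply, Matrix.of_apply, Matrix.of_apply]
    exact map_monomialFun R a b i j hi hj l
  g_mul i j l V hi hj hl := by
    ext p q
    rw [Matrix.mul_apply, Fin.sum_univ_one, Matrix.of_apply, Matrix.of_apply, Matrix.of_apply]
    exact monomialFun_mul R a b i j l V hi hj hl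
  g_self i V hi := by
    ext p q
    rw [Matrix.of_apply, monomialFun_self, Subsingleton.elim p q, Matrix.one_apply_eq]

/-- The glued module of the monomial cocycle is finite locally free. [folklore] -/
theorem isFiniteLocallyFree_monomialGlued : Motives.IsFiniteLocallyFree (monomialCocycle R a b).glued :=
  (monomialCocycle R a b).isFiniteLocallyFree_glued fun x => by
    have hx : x ∈ (⊤ : (ProjCech.PP R 1).Opens) := trivial
    rw [← ProjCech.iSup_cover_eq_top (𝟙 (ProjCech.PP R 1))] at hx
    exact Opens.mem_iSup.mp hx

end Cocycle

/-! ### Chart functions under base change: `g♯(x_i/x_j) = x_i/x_j` -/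

section BaseChange

variable (A k : Type) [CommRing A] [CommRing k] [Algebra A k]

/-- `A[x] → k[x]` maps the monomial `X_s` to `X_s`. [folklore] -/
theorem mapGraded_Xs (s : Finset (Fin 2)) : mapGraded A k (Fin 2) (Xs A s) = Xs k s := by
  rw [mapGraded_apply]
  unfold Xs
  rw [map_prod]
  exact Finset.prod_congr rfl fun i _ => MvPolynomial.map_X _ i

/-- The chart function `x_i/x_j` is `awayToSection` of the degree-zero fraction `X_{{i}∖j} / X_{{j}}`. [folklore] -/
theorem chartFun_eq_awayToSection (R : Type) [CommRing R] (i j : Fin 2) :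
    SerreTwist.chartFun (𝟙 (ProjCech.PP R 1)) i j =
      Proj.awayToSection (ProjCech.grading R 1) (Xs R {j})
        (HomogeneousLocalization.Away.isLocalizationElem (Xs_mem (A := R) {j}) (Xs_mem (({i} : Finset (Fin 2)).erase j))) := by
  change ProjCech.evalRing (𝟙 (ProjCech.PP R 1)) {j} (ProjCech.tElB R {i} j) = _
  rw [ProjCech.evalRing_apply, Scheme.Hom.id_app, ProjCech.awayEquiv_symm_tElB]
  rfl

/-- Transport of `awayToSection` of a fraction along an equality of denominators and numerators. [folklore] -/
theorem map_homOfLE_awayToSection_mk (R : Type) [CommRing R] {f f' p p' : MvPolynomial (Fin 2) R} (h : f = f')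
    (hp' : p = p') {d : ℕ} (hf : f ∈ ProjCech.grading R 1 d) (hf' : f' ∈ ProjCech.grading R 1 d) (n : ℕ)
    (hp : p ∈ ProjCech.grading R 1 (n • d)) (hpp : p' ∈ ProjCech.grading R 1 (n • d)) :
    (ProjCech.PP R 1).presheaf.map
        (homOfLE (le_of_eq (congrArg (Proj.basicOpen (ProjCech.grading R 1)) h)) :
          Proj.basicOpen (ProjCech.grading R 1) f ⟶ Proj.basicOpen (ProjCech.grading R 1) f').op
        (Proj.awayToSection (ProjCech.grading R 1) f' (HomogeneousLocalization.Away.mk _ hf' n p' hpp)) =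
      Proj.awayToSection (ProjCech.grading R 1) f (HomogeneousLocalization.Away.mk _ hf n p hp) := by
  subst h; subst hp'
  rw [show (homOfLE (le_of_eq (congrArg (Proj.basicOpen (ProjCech.grading R 1)) (rfl : f = f)))) = 𝟙 _ from
      Subsingleton.elim _ _, op_id, CategoryTheory.Functor.map_id]
  rfl

/-- **`g♯(x_i/x_j) = x_i/x_j`** for the base change `g = Proj(A[x] → k[x]) : ℙ¹_k → ℙ¹_A` (on `D₊(x_j)`). [folklore] -/
theorem appLE_projMap_chartFun (i j : Fin 2) :
    (Proj.map (mapGraded A k (Fin 2)) (irrelevant_le_map A k (Fin 2))).appLE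
        (ProjCech.Zop (𝟙 (ProjCech.PP A 1)) {j}) (ProjCech.Zop (𝟙 (ProjCech.PP k 1)) {j})
        (le_of_eq (projMap_preimage_Dplus A 1 k {j}).symm)
        (SerreTwist.chartFun (𝟙 (ProjCech.PP A 1)) i j) =
      SerreTwist.chartFun (𝟙 (ProjCech.PP k 1)) i j := by
  have hXs : mapGraded A k (Fin 2) (Xs A {j}) = Xs k {j} := mapGraded_Xs A k {j}
  have e : ProjCech.Zop (𝟙 (ProjCech.PP k 1)) {j} ≤
      Proj.basicOpen (ProjCech.grading k 1) (mapGraded A k (Fin 2) (Xs A {j})) := le_of_eq (by rw [hXs]; rfl)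
  -- morphism identities: factor `appLE` through `D₊(f X_{{j}})`, and Mathlib's `awayToSection_comp_appLE`
  have M := Proj.awayToSection_comp_appLE (mapGraded A k (Fin 2)) (irrelevant_le_map A k (Fin 2)) (Xs_mem (A := A) {j})
  have M2 : (Proj.map (mapGraded A k (Fin 2)) (irrelevant_le_map A k (Fin 2))).appLE
        (ProjCech.Zop (𝟙 (ProjCech.PP A 1)) {j}) (ProjCech.Zop (𝟙 (ProjCech.PP k 1)) {j})
        (le_of_eq (projMap_preimage_Dplus A 1 k {j}).symm) =
      (Proj.map (mapGraded A k (Fin 2)) (irrelevant_le_map A k (Fin 2))).appLE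
        (Proj.basicOpen (ProjCech.grading A 1) (Xs A {j}))
        (Proj.basicOpen (ProjCech.grading k 1) (mapGraded A k (Fin 2) (Xs A {j}))) (by rfl) ≫
        (ProjCech.PP k 1).presheaf.map (homOfLE e).op :=
    (Scheme.Hom.appLE_map _ _ _).symm
  rw [chartFun_eq_awayToSection, M2]
  change ((ProjCech.PP k 1).presheaf.map (homOfLE e).op).hom
      ((Proj.awayToSection (ProjCech.grading A 1) (Xs A {j}) ≫
        (Proj.map (mapGraded A k (Fin 2)) (irrelevant_le_map A k (Fin 2))).appLE
          (Proj.basicOpen (ProjCech.grading A 1) (Xs A {j}))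
          (Proj.basicOpen (ProjCech.grading k 1) (mapGraded A k (Fin 2) (Xs A {j}))) (by rfl)).hom
        (HomogeneousLocalization.Away.isLocalizationElem (Xs_mem (A := A) {j})
          (Xs_mem (({i} : Finset (Fin 2)).erase j)))) = _
  rw [M]
  change ((ProjCech.PP k 1).presheaf.map (homOfLE e).op).hom
      ((Proj.awayToSection (ProjCech.grading k 1) (mapGraded A k (Fin 2) (Xs A {j}))).hom
        (HomogeneousLocalization.Away.map (mapGraded A k (Fin 2)) (Xs A {j})
          (HomogeneousLocalization.Away.mk _ (Xs_mem (A := A) {j}) _ (Xs A (({i} : Finset (Fin 2)).erase j) ^ _) _))) = _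
  rw [HomogeneousLocalization.Away.map_mk, chartFun_eq_awayToSection]
  exact map_homOfLE_awayToSection_mk k hXs.symm (by rw [map_pow, mapGraded_Xs]) _ _ _ _ _

/-- Hence `g♯` carries the monomial transition functions over `A` to those over `k`. [folklore] -/
theorem appLE_projMap_monomialFun (a b : ℕ) (i j : Fin 2) {V : (ProjCech.PP k 1).Opens}
    (hi : V ≤ ProjCech.Zop (𝟙 (ProjCech.PP k 1)) {i}) (hj : V ≤ ProjCech.Zop (𝟙 (ProjCech.PP k 1)) {j})
    {W : (ProjCech.PP A 1).Opens} (hWi : W ≤ ProjCech.Zop (𝟙 (ProjCech.PP A 1)) {i})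
    (hWj : W ≤ ProjCech.Zop (𝟙 (ProjCech.PP A 1)) {j})
    (hVW : V ≤ Proj.map (mapGraded A k (Fin 2)) (irrelevant_le_map A k (Fin 2)) ⁻¹ᵁ W) :
    (Proj.map (mapGraded A k (Fin 2)) (irrelevant_le_map A k (Fin 2))).appLE W V hVW (monomialFun A a b i j W hWi hWj) =
      monomialFun k a b i j V hi hj := by
  have key : ∀ (i j : Fin 2) (hWj : W ≤ ProjCech.Zop (𝟙 (ProjCech.PP A 1)) {j}) (hj : V ≤ ProjCech.Zop (𝟙 (ProjCech.PP k 1)) {j}),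
      (Proj.map (mapGraded A k (Fin 2)) (irrelevant_le_map A k (Fin 2))).appLE W V hVW
        ((ProjCech.PP A 1).presheaf.map (homOfLE hWj).op (SerreTwist.chartFun (𝟙 (ProjCech.PP A 1)) i j)) =
      (ProjCech.PP k 1).presheaf.map (homOfLE hj).op (SerreTwist.chartFun (𝟙 (ProjCech.PP k 1)) i j) := by
    intro i j hWj hj
    have L := Scheme.Hom.map_appLE (Proj.map (mapGraded A k (Fin 2)) (irrelevant_le_map A k (Fin 2))) hVW
      (homOfLE hWj).op
    have R := Scheme.Hom.appLE_map (Proj.map (mapGraded A k (Fin 2)) (irrelevant_le_map A k (Fin 2)))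
      (U := ProjCech.Zop (𝟙 (ProjCech.PP A 1)) {j}) (le_of_eq (projMap_preimage_Dplus A 1 k {j}).symm) (homOfLE hj).op
    have LR := congrArg (fun φ => φ.hom (SerreTwist.chartFun (𝟙 (ProjCech.PP A 1)) i j)) (L.trans R.symm)
    simp only [CommRingCat.hom_comp, RingHom.coe_comp, Function.comp_apply] at LR
    rw [← appLE_projMap_chartFun A k i j]
    exact LR
  unfold monomialFun
  rw [map_mul, map_pow, map_pow, key j i hWi hi, key i j hWj hj]

end BaseChange

/-! ### Frames of size one on a two-member cover: transition equality on one ordered pair suffices -/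

section FinOne

variable {X : Scheme.{0}} {M N : X.Modules} (U : Fin 2 → X.Opens)
  (E : ∀ i, SheafOfModules.free (Fin 1) ≅ M.over (U i)) (F : ∀ i, SheafOfModules.free (Fin 1) ≅ N.over (U i))

/-- For two families of size-one frames on the same two opens, if the `(0,1)` transition functions agree over every open
below `U₀ ∩ U₁`, then ALL transition matrices agree (the `(1,0)` ones are the inverses, the diagonal ones are `1`). [folklore] -/
theorem transition_eq_of_fin_one
    (h01 : ∀ (V : X.Opens) (h0 : V ≤ U 0) (h1 : V ≤ U 1),
      transition (E 0) (E 1) (homOfLE h0) (homOfLE h1) 0 0 = transition (F 0) (F 1) (homOfLE h0) (homOfLE h1) 0 0)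
    (i j : Fin 2) :
    transition (E i) (E j) (Opens.infLELeft (U i) (U j)) (Opens.infLERight (U i) (U j)) =
      transition (F i) (F j) (Opens.infLELeft (U i) (U j)) (Opens.infLERight (U i) (U j)) := by
  classical
  have hdiag : ∀ i, transition (E i) (E i) (Opens.infLELeft (U i) (U i)) (Opens.infLERight (U i) (U i)) =
      transition (F i) (F i) (Opens.infLELeft (U i) (U i)) (Opens.infLERight (U i) (U i)) := fun i => by
    rw [show Opens.infLERight (U i) (U i) = Opens.infLELeft (U i) (U i) from Subsingleton.elim _ _,
      transition_self, transition_self]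
  revert i j
  refine Fin.forall_fin_two.mpr ⟨Fin.forall_fin_two.mpr ⟨hdiag 0, ?_⟩, Fin.forall_fin_two.mpr ⟨?_, hdiag 1⟩⟩
  · ext p q
    rw [Subsingleton.elim p 0, Subsingleton.elim q 0]
    exact h01 _ inf_le_left inf_le_right
  · ext p q
    rw [Subsingleton.elim p 0, Subsingleton.elim q 0]
    -- both `(1,0)` transition functions are inverse to the common `(0,1)` one over `U₁ ∩ U₀`
    have hE := transition_mul_transition_fin_one (E 1) (E 0) (Opens.infLELeft (U 1) (U 0)) (Opens.infLERight (U 1) (U 0))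
    have hF := transition_mul_transition_fin_one (F 1) (F 0) (Opens.infLELeft (U 1) (U 0)) (Opens.infLERight (U 1) (U 0))
    have h := h01 (U 1 ⊓ U 0) inf_le_right inf_le_left
    change transition (E 0) (E 1) (Opens.infLERight (U 1) (U 0)) (Opens.infLELeft (U 1) (U 0)) 0 0 =
      transition (F 0) (F 1) (Opens.infLERight (U 1) (U 0)) (Opens.infLELeft (U 1) (U 0)) 0 0 at h
    rw [h] at hE
    calc transition (E 1) (E 0) (Opens.infLELeft (U 1) (U 0)) (Opens.infLERight (U 1) (U 0)) 0 0
        = transition (E 1) (E 0) (Opens.infLELeft (U 1) (U 0)) (Opens.infLERight (U 1) (U 0)) 0 0 *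
            (transition (F 0) (F 1) (Opens.infLERight (U 1) (U 0)) (Opens.infLELeft (U 1) (U 0)) 0 0 *
              transition (F 1) (F 0) (Opens.infLELeft (U 1) (U 0)) (Opens.infLERight (U 1) (U 0)) 0 0) := by
          rw [mul_comm (transition (F 0) (F 1) _ _ 0 0), hF, mul_one]
      _ = transition (F 1) (F 0) (Opens.infLELeft (U 1) (U 0)) (Opens.infLERight (U 1) (U 0)) 0 0 := by
          rw [← mul_assoc, hE, one_mul]

end FinOne

/-! ### Base change of the glued line bundle: `g^* 𝒪_{ℙ¹_A}(b − a) ≅ 𝒪_{ℙ¹_k}(b − a)` -/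

section GluedBaseChange

variable (A k : Type) [CommRing A] [CommRing k] [Algebra A k] (a b : ℕ)

/-- **The glued line bundle of the monomial cocycle commutes with base change**: for `g = Proj(A[x] → k[x]) : ℙ¹_k → ℙ¹_A`,
`g^*(glued_A) ≅ glued_k` (the pulled-back frames have the pulled-back transition functions `g♯((x₁/x₀)^a(x₀/x₁)^b) =
(x₁/x₀)^a(x₀/x₁)^b`; tree `PullbackFrame.transition_pullbackFrame`, `IsoOfFrames.isoOfFrames`). [folklore] -/
theorem nonempty_iso_pullback_monomialGlued :
    Nonempty ((Scheme.Modules.pullback (Proj.map (mapGraded A k (Fin 2)) (irrelevant_le_map A k (Fin 2)))).obj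
        (monomialCocycle A a b).glued ≅ (monomialCocycle k a b).glued) := by
  let g := Proj.map (mapGraded A k (Fin 2)) (irrelevant_le_map A k (Fin 2))
  let cA := monomialCocycle A a b
  let ck := monomialCocycle k a b
  have hpre : ∀ i : Fin 2, ck.U i ≤ g ⁻¹ᵁ cA.U i := fun i => le_of_eq (projMap_preimage_Dplus A 1 k {i}).symm
  -- frames of `g^* glued_A` on the charts of `ℙ¹_k`
  let e : ∀ i : Fin 2, SheafOfModules.free (Fin 1) ≅ ((Scheme.Modules.pullback g).obj cA.glued).over (ck.U i) := fun i =>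
    Motives.SheafOfModules.restrictTrivialisation (R := (ProjCech.PP k 1).ringCatSheaf) (homOfLE (hpre i))
      (pullbackFrame g (cA.frame i))
  refine ⟨isoOfFrames (M := (Scheme.Modules.pullback g).obj cA.glued) (N := ck.glued) ck.U e ck.frame ?_
    (ProjCech.iSup_cover_eq_top (𝟙 (ProjCech.PP k 1)))⟩
  intro i j
  have hl : ck.U i ⊓ ck.U j ≤ g ⁻¹ᵁ (cA.U i ⊓ cA.U j) := inf_le_inf (hpre i) (hpre j)
  rw [transition_restrictTrivialisation, transition_pullbackFrame g (cA.frame i) (cA.frame j) hl, cA.transition_frame,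
    ck.transition_frame]
  ext p q
  rw [Matrix.map_apply]
  exact appLE_projMap_monomialFun A k a b i j _ _ _ _ hl

end GluedBaseChange

/-! ### Every line bundle on `ℙ¹_k` is `𝒪(d)`, and is the restriction of a line bundle on `ℙ¹_A` -/

section LineBundles

variable (k : Type) [Field k]

/-- **A line bundle on `ℙ¹_k` is the glued bundle of a monomial cocycle**: `L ≅ 𝒪(b − a)` (part 6
`exists_frames_transition_eq_monomial` + tree `isoOfFrames`). [folklore] -/
theorem exists_iso_monomialGlued (L : (ProjCech.PP k 1).Modules)
    (hL : ∀ x : ProjCech.PP k 1, ∃ (W : (ProjCech.PP k 1).Opens) (_ : x ∈ W),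
      Nonempty (SheafOfModules.free (Fin 1) ≅ L.over W)) :
    ∃ a b : ℕ, Nonempty (L ≅ (monomialCocycle k a b).glued) := by
  classical
  obtain ⟨e₀, e₁, a, b, hT⟩ := exists_frames_transition_eq_monomial k L hL
  let ck := monomialCocycle k a b
  let E : ∀ i : Fin 2, SheafOfModules.free (Fin 1) ≅ L.over (ck.U i) := Fin.cons e₀ (Fin.cons e₁ fun i => Fin.elim0 i)
  refine ⟨a, b, ⟨isoOfFrames (M := L) (N := ck.glued) ck.U E ck.frame ?_ (ProjCech.iSup_cover_eq_top (𝟙 (ProjCech.PP k 1)))⟩⟩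
  refine transition_eq_of_fin_one ck.U E ck.frame fun V h0 h1 => ?_
  change transition e₀ e₁ (homOfLE h0) (homOfLE h1) 0 0 =
    transition (ck.frame 0) (ck.frame 1) (homOfLE h0) (homOfLE h1) (0 : Fin 1) (0 : Fin 1)
  rw [ck.transition_frame]
  change _ = monomialFun k a b 0 1 V h0 h1
  -- restrict part 6's identity from `U₀ ∩ U₁` to `V`
  have hV : V ≤ ProjCech.Dplus k 1 {0} ⊓ ProjCech.Dplus k 1 {1} := le_inf h0 h1
  have hres := congrFun (congrFun (transition_map e₀ e₁ (homOfLE (inf_le_left : ProjCech.Dplus k 1 {0} ⊓ ProjCech.Dplus k 1 {1} ≤ _))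
    (homOfLE (inf_le_right : ProjCech.Dplus k 1 {0} ⊓ ProjCech.Dplus k 1 {1} ≤ _)) (homOfLE hV)) 0) 0
  rw [Matrix.map_apply, hT] at hres
  rw [show homOfLE h0 = homOfLE hV ≫ homOfLE (inf_le_left : ProjCech.Dplus k 1 {0} ⊓ ProjCech.Dplus k 1 {1} ≤ _) from
      Subsingleton.elim _ _,
    show homOfLE h1 = homOfLE hV ≫ homOfLE (inf_le_right : ProjCech.Dplus k 1 {0} ⊓ ProjCech.Dplus k 1 {1} ≤ _) from
      Subsingleton.elim _ _, ← hres]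
  exact map_monomialFun k a b 0 1 inf_le_left inf_le_right hV

variable (A : Type) [CommRing A] [Algebra A k]

/-- **T-P1VB part 7 — every line bundle on `ℙ¹_k` is the restriction of a line bundle on `ℙ¹_A`**: for any commutative
ring `A` with an algebra map `A → k` to a field (e.g. a local ring onto its residue field) and `g = Proj(A[x] → k[x]) :
ℙ¹_k → ℙ¹_A`, every `L` on `ℙ¹_k` free of rank one near every point is `≅ g^* L̃` for the finite locally free
`L̃ = glued_A(a, b) = 𝒪_{ℙ¹_A}(b − a)` (`isFiniteLocallyFree_monomialGlued`). This is supplier debt (c) of `Cruxes/…/DIRSTEP.lean`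
(lifting the downstairs line bundle `K₀` to the `O`-curve). [folklore] -/
theorem exists_iso_pullback_of_lineBundle (L : (ProjCech.PP k 1).Modules)
    (hL : ∀ x : ProjCech.PP k 1, ∃ (W : (ProjCech.PP k 1).Opens) (_ : x ∈ W),
      Nonempty (SheafOfModules.free (Fin 1) ≅ L.over W)) :
    ∃ a b : ℕ, Nonempty (L ≅ (Scheme.Modules.pullback (Proj.map (mapGraded A k (Fin 2)) (irrelevant_le_map A k (Fin 2)))).obj
      (monomialCocycle A a b).glued) := by
  obtain ⟨a, b, ⟨φ⟩⟩ := exists_iso_monomialGlued k L hL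
  obtain ⟨ψ⟩ := nonempty_iso_pullback_monomialGlued A k a b
  exact ⟨a, b, ⟨φ ≪≫ ψ.symm⟩⟩

end LineBundles

end Summit.ResolutionOfSingularities.ResolutionOfSingularities.Cruxes.EquisingularLiftNat.P1VB

end
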